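import Summits.ResolutionOfSingularities.ResolutionOfSingularities.Theorems.HomologicalConductorSurfaceTerminationPrintDebtDoorsThree
import HarnessLib

/-!
# Kill test `SurfaceTermination` (stmt-ResolutionOfSingularities-16488): the MEET of the two doors —
# the residue is only «eternal positive constant genus WITH cofinally failing capture is impossible»

Route `ResolutionOfSingularities/HomologicalConductor`.  OURS (hand leafhand-res-homologicalconduct-20 g1, 2026-08-31);
nothing here is a statement of the manuscript under review (Hironaka 2017); AI-written, weaker than expert review.

The kill test has two doors with the same three prints {`CossartJannsenSaito2020General`, `Lipman1969_4_1`,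
`Lipman1969_12_1_ii`}: the GENUS door (`PrintDebtDoors.surfaceTermination_of_prints3_of_noEternalGenus`: «no eternal positive
constant geometric genus along a prime divisor») and the CAPTURE door (`PrintDebtDoors.surfaceTermination_of_prints_of_nonrationalCapture`,
hand 20 g0: «`ca(T)·S` principal for every regular local `S` dominating every singular non-rational stage `T`»).  Their residues
are both implied by — and the kill test needs only — their MEET:

* **`primeDivisorSurfaceTermination_of_prints3_of_meet` / `surfaceTermination_of_prints3_of_meet`** — THREE prints + «along a prime
  divisor, an eternal positive constant geometric genus together with capture failing at COFINALLY MANY singular non-rational stages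
  is impossible» ⇒ `SurfaceTermination` BY NAME.  Proof: given an eternal constant genus `g + 1 ≥ 1` from stage `m + 1` on, either
  capture fails cofinally (the hypothesis ends it), or capture holds at every singular stage from some `m₁ + 1 ≥ m + 1` on — at
  rational ones by THEOREM A (`RationalDescent.FourFacts.isPrincipal_map_ca_of_isRegularLocalRing_dominating4`), at non-rational ones
  by assumption — and then hand 20's FACT-FREE E-descent `CaptureDescent.termination_of_capture` (with a CJS resolution of
  `T_(m₁+1)`) yields a regular stage, which is terminal and rational, hence of genus `0 ≤ g`: contradiction.  So there is no eternal
  positive constant genus, and the genus door applies.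
* `meet_of_primeDivisorCapture`, **`surfaceTermination_of_prints3_of_primeDivisorCapture`** — hand 20's capture residue
  (CAP¬rat, asked along EVERY valuation) is needed only along PRIME DIVISORS (`O ≠ ⊤`, DVR, residually of transcendence degree
  `trdeg K − 1`): three prints + capture at the singular non-rational stages of prime-divisor towers ⇒ `SurfaceTermination`.  (The genus
  residue implies the meet tautologically: the meet's hypotheses contain the eternal genus.)

No new definitions; named-fact hypotheses explicit.  No crux, kill test or summit statement is proved here; resolution of
singularities in positive characteristic is NOT proved.

References: J. Lipman, Publ. Math. IHÉS 36 (1969), (4.1), (12.1) [`Lipman1969`]; V. Cossart, U. Jannsen, S. Saito (2020),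
Thm. 1.2 [`CossartJannsenSaito2020`]; O. Zariski, P. Samuel, *Commutative Algebra* II, Ch. VI §14 [`ZariskiSamuel1960`].
-/

set_option linter.dupNamespace false

noncomputable section

namespace Summit.ResolutionOfSingularities.ResolutionOfSingularities.Theorems.SurfaceTermination.PrintDebtDoors

open Summit.ResolutionOfSingularities.ResolutionOfSingularities.Theses.HomologicalConductor (SurfaceTermination)
open Summit.ResolutionOfSingularities.ResolutionOfSingularities.Theorems
open Summit.ResolutionOfSingularities.ResolutionOfSingularities.Theorems.NoZeno.Birth
open Summit.ResolutionOfSingularities.ResolutionOfSingularities.Theorems.NoZeno.SandwichCluster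
open Summit.ResolutionOfSingularities.ResolutionOfSingularities.Theorems.SurfaceTermination.GenusDescent
open Summit.ResolutionOfSingularities.ResolutionOfSingularities.Theorems.SurfaceTermination.GenusDescentDoor
open Summit.ResolutionOfSingularities.ResolutionOfSingularities.Theorems.SurfaceTermination.Descent
open Summit.ResolutionOfSingularities.ResolutionOfSingularities.Theorems.SurfaceTermination.CaptureDescent
open Summit.ResolutionOfSingularities.ResolutionOfSingularities.Theorems.SurfaceTermination.Reduction
  (PrimeDivisorSurfaceTermination)
open Literature.AlgebraicGeometry.Resolution Literature.AlgebraicGeometry.Morphisms Polynomial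
open Literature.RingTheory.CohomologyAnnihilator (cohomologyAnnihilator)
open CategoryTheory AlgebraicGeometry

variable {k K : Type} [Field k] [Field K] [Algebra k K]

/-- **THREE prints + the MEET residue ⇒ the prime-divisor case (D-s).**  Meet residue: along a prime divisor `O`, if the
geometric genus of the stages `T_(m'+1)` is the constant `g + 1 ≥ 1` for all `m' ≥ m`, then capture cannot fail at cofinally
many singular non-rational stages — i.e. it is impossible that for every `m₁` some singular non-rational stage `T_i`,
`i ≥ m₁ + 1`, has a regular local `S ⊇ T_i` (essentially of finite type, dominating) with `ca(T_i)·S` NOT principal.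
Proof: otherwise-case = capture from some `m₁ + 1` on (rational stages by THEOREM A mod the prints), so
`termination_of_capture` gives a regular stage, contradicting the eternal positive genus; hence no eternal positive constant
genus, and `primeDivisorSurfaceTermination_of_prints3_of_noEternalGenus` applies.
[cite: CossartJannsenSaito2020, Thm. 1.2] [cite: Lipman1969, Theorem (4.1) (p. 204) and Theorem (12.1) (ii) (p. 220)] -/
theorem primeDivisorSurfaceTermination_of_prints3_of_meet
    (hCJS : CossartJannsenSaito2020General.{0}) (h41 : Lipman1969_4_1.{0}) (h12ii : Lipman1969_12_1_ii.{0})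
    (hMeet : ∀ p : ℕ, p.Prime → ∀ (k K : Type) [Field k] [CharP k p] [Field K] [Algebra k K]
      (O : ValuationSubring K) (A : Subalgebra k K) (hk : ∀ c : k, algebraMap k K c ∈ O), A.FG →
      IsFractionRing ↥A K → A.toSubring ≤ O.toSubring → ringKrullDim ↥A = 2 →
      O ≠ ⊤ → IsDiscreteValuationRing ↥O → residueTrdeg k O hk + 1 = Algebra.trdeg k K →
      ∀ g m : ℕ, (∀ m' : ℕ, m ≤ m' →
        HasGeometricGenusLE ↥(tower O A (m' + 1)) (g + 1) ∧ ¬ HasGeometricGenusLE ↥(tower O A (m' + 1)) g) →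
        (∀ m₁ : ℕ, ∃ i : ℕ, m₁ + 1 ≤ i ∧ ¬ IsRegularLocalRing ↥(tower O A i) ∧
          ¬ HasRationalSingularity ↥(tower O A i) ∧
          ∃ (S : Subalgebra k K) (hTS : tower O A i ≤ S),
            (∀ t ∈ tower O A i, t⁻¹ ∈ S → t⁻¹ ∈ tower O A i) ∧ IsRegularLocalRing ↥S ∧
            Algebra.EssFiniteType k ↥S ∧
            ¬ (Ideal.map (Subalgebra.inclusion hTS).toRingHom (cohomologyAnnihilator ↥(tower O A i))).IsPrincipal) →
        False) :
    PrimeDivisorSurfaceTermination := by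
  classical
  have h12 : Lipman1969_1_2.{0} := NoZeno.Lipman12B.Lipman1969_1_2_holds
  have hF4 : (CossartJannsenSaito2020General.{0} ∧ Lipman1969_1_2.{0} ∧ Lipman1969_4_1.{0} ∧
      Lipman1969_12_1_ii.{0}) := ⟨hCJS, h12, h41, h12ii⟩
  refine primeDivisorSurfaceTermination_of_prints3_of_noEternalGenus hCJS h41 h12ii ?_
  intro p hp k K _ _ _ _ O A hk hA hfr hAO hdim hOtop hdvr hres g m hconst
  haveI := hfr
  have htr : Algebra.trdeg k K = 2 := trdeg_eq_two_of_ringKrullDim A hA hfr hdim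
  -- a regular stage anywhere contradicts the eternal positive genus
  have no_regular : ∀ m'' : ℕ, ¬ IsRegularLocalRing ↥(tower O A m'') := by
    intro m'' hreg
    have hreg' : IsRegularLocalRing ↥(tower O A (m'' + m + 1)) :=
      isRegularLocalRing_tower_of_le O A hk hfr hAO (by omega) hreg
    have hrat : HasRationalSingularity ↥(tower O A (m'' + m + 1)) := by
      haveI := hreg'
      exact hasRationalSingularity_of_isRegularLocalRing _
    exact (hconst (m'' + m) (Nat.le_add_left m m'')).2
      (hasGeometricGenusLE_mono (Nat.zero_le g) ((hasGeometricGenusLE_zero_iff _).mpr hrat))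
  -- either capture fails cofinally (the meet hypothesis ends it) …
  by_cases hcof : ∀ m₁ : ℕ, ∃ i : ℕ, m₁ + 1 ≤ i ∧ ¬ IsRegularLocalRing ↥(tower O A i) ∧
      ¬ HasRationalSingularity ↥(tower O A i) ∧
      ∃ (S : Subalgebra k K) (hTS : tower O A i ≤ S),
        (∀ t ∈ tower O A i, t⁻¹ ∈ S → t⁻¹ ∈ tower O A i) ∧ IsRegularLocalRing ↥S ∧
        Algebra.EssFiniteType k ↥S ∧
        ¬ (Ideal.map (Subalgebra.inclusion hTS).toRingHom (cohomologyAnnihilator ↥(tower O A i))).IsPrincipal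
  · exact hMeet p hp k K O A hk hA hfr hAO hdim hOtop hdvr hres g m hconst hcof
  -- … or capture holds at every singular non-rational stage from some `m₁ + 1` on
  push Not at hcof
  obtain ⟨m₁, hm₁⟩ := hcof
  have hsing₁ : ¬ IsRegularLocalRing ↥(tower O A (m₁ + 1)) := no_regular _
  -- a CJS resolution of the singular stage `T_(m₁+1)`
  obtain ⟨hTnoeth, hTnorm, -, hTloc, hdimT, hET⟩ :=
    SurfaceTermination.RationalDescent.stage_package_of_trdeg O A hk hA hfr hAO htr m₁ hsing₁
  haveI := hTnoeth; haveI := hTnorm; haveI := hTloc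
  obtain ⟨X, π, hπ⟩ := exists_isResolution_Spec_of_cjsGeneral hCJS k ↥(tower O A (m₁ + 1)) hET hdimT.le
  -- the fact-free E-descent ends the tower: contradiction
  obtain ⟨m'', hreg⟩ := termination_of_capture O A hk hA hfr hAO hdim m₁ hsing₁ ⟨X, π, hπ⟩ (by
    intro i hi hsingi S hTS hdomS hSreg hSeft
    obtain ⟨d, rfl⟩ : ∃ d, i = d + 1 := ⟨i - 1, by omega⟩
    by_cases hrat : HasRationalSingularity ↥(tower O A (d + 1))
    · exact RationalDescent.FourFacts.isPrincipal_map_ca_of_isRegularLocalRing_dominating4 hF4 O A hk hA hfr hAO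
        htr d hsingi hrat S hTS hdomS hSreg hSeft
    · exact hm₁ (d + 1) hi hsingi hrat S hTS hdomS hSreg hSeft)
  exact no_regular m'' hreg

/-- **THREE prints + the MEET residue ⇒ `SurfaceTermination` BY NAME** (through the four-print reduction to the prime-divisor
case, Lipman (1.2) from the tree). [cite: CossartJannsenSaito2020, Thm. 1.2]
[cite: Lipman1969, Theorem (4.1) (p. 204) and Theorem (12.1) (ii) (p. 220)] -/
theorem surfaceTermination_of_prints3_of_meet
    (hCJS : CossartJannsenSaito2020General.{0}) (h41 : Lipman1969_4_1.{0}) (h12ii : Lipman1969_12_1_ii.{0})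
    (hMeet : ∀ p : ℕ, p.Prime → ∀ (k K : Type) [Field k] [CharP k p] [Field K] [Algebra k K]
      (O : ValuationSubring K) (A : Subalgebra k K) (hk : ∀ c : k, algebraMap k K c ∈ O), A.FG →
      IsFractionRing ↥A K → A.toSubring ≤ O.toSubring → ringKrullDim ↥A = 2 →
      O ≠ ⊤ → IsDiscreteValuationRing ↥O → residueTrdeg k O hk + 1 = Algebra.trdeg k K →
      ∀ g m : ℕ, (∀ m' : ℕ, m ≤ m' →
        HasGeometricGenusLE ↥(tower O A (m' + 1)) (g + 1) ∧ ¬ HasGeometricGenusLE ↥(tower O A (m' + 1)) g) →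
        (∀ m₁ : ℕ, ∃ i : ℕ, m₁ + 1 ≤ i ∧ ¬ IsRegularLocalRing ↥(tower O A i) ∧
          ¬ HasRationalSingularity ↥(tower O A i) ∧
          ∃ (S : Subalgebra k K) (hTS : tower O A i ≤ S),
            (∀ t ∈ tower O A i, t⁻¹ ∈ S → t⁻¹ ∈ tower O A i) ∧ IsRegularLocalRing ↥S ∧
            Algebra.EssFiniteType k ↥S ∧
            ¬ (Ideal.map (Subalgebra.inclusion hTS).toRingHom (cohomologyAnnihilator ↥(tower O A i))).IsPrincipal) →
        False) :
    SurfaceTermination := by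
  have h12 : Lipman1969_1_2.{0} := NoZeno.Lipman12B.Lipman1969_1_2_holds
  exact Reduction.FourFacts.surfaceTermination_of_primeDivisorCase_of_facts4 ⟨hCJS, h12, h41, h12ii⟩
    (primeDivisorSurfaceTermination_of_prints3_of_meet hCJS h41 h12ii hMeet)

/-- **Capture at the non-rational stages of PRIME-DIVISOR towers implies the meet residue.**  Hand 20's (CAP¬rat) asked for
capture along every valuation; after the reduction to the prime-divisor case only towers along prime divisors `O` (`O ≠ ⊤`, a
DVR, residually of transcendence degree `trdeg K − 1`) matter, so the capture hypothesis may carry those three extra binders.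
A cofinal capture failure at a singular non-rational stage contradicts it at that stage. [this work] -/
theorem meet_of_primeDivisorCapture
    (hCAP : ∀ p : ℕ, p.Prime → ∀ (k K : Type) [Field k] [CharP k p] [Field K] [Algebra k K]
      (O : ValuationSubring K) (A : Subalgebra k K) (hk : ∀ c : k, algebraMap k K c ∈ O), A.FG →
      IsFractionRing ↥A K → A.toSubring ≤ O.toSubring → ringKrullDim ↥A = 2 →
      O ≠ ⊤ → IsDiscreteValuationRing ↥O → residueTrdeg k O hk + 1 = Algebra.trdeg k K →
      ∀ m : ℕ, ¬ IsRegularLocalRing ↥(tower O A (m + 1)) → ¬ HasRationalSingularity ↥(tower O A (m + 1)) →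
      ∀ (S : Subalgebra k K) (hTS : tower O A (m + 1) ≤ S),
        (∀ t ∈ tower O A (m + 1), t⁻¹ ∈ S → t⁻¹ ∈ tower O A (m + 1)) →
        IsRegularLocalRing ↥S → Algebra.EssFiniteType k ↥S →
        (Ideal.map (Subalgebra.inclusion hTS).toRingHom
          (cohomologyAnnihilator ↥(tower O A (m + 1)))).IsPrincipal) :
    ∀ p : ℕ, p.Prime → ∀ (k K : Type) [Field k] [CharP k p] [Field K] [Algebra k K]
      (O : ValuationSubring K) (A : Subalgebra k K) (hk : ∀ c : k, algebraMap k K c ∈ O), A.FG →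
      IsFractionRing ↥A K → A.toSubring ≤ O.toSubring → ringKrullDim ↥A = 2 →
      O ≠ ⊤ → IsDiscreteValuationRing ↥O → residueTrdeg k O hk + 1 = Algebra.trdeg k K →
      ∀ g m : ℕ, (∀ m' : ℕ, m ≤ m' →
        HasGeometricGenusLE ↥(tower O A (m' + 1)) (g + 1) ∧ ¬ HasGeometricGenusLE ↥(tower O A (m' + 1)) g) →
        (∀ m₁ : ℕ, ∃ i : ℕ, m₁ + 1 ≤ i ∧ ¬ IsRegularLocalRing ↥(tower O A i) ∧
          ¬ HasRationalSingularity ↥(tower O A i) ∧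
          ∃ (S : Subalgebra k K) (hTS : tower O A i ≤ S),
            (∀ t ∈ tower O A i, t⁻¹ ∈ S → t⁻¹ ∈ tower O A i) ∧ IsRegularLocalRing ↥S ∧
            Algebra.EssFiniteType k ↥S ∧
            ¬ (Ideal.map (Subalgebra.inclusion hTS).toRingHom (cohomologyAnnihilator ↥(tower O A i))).IsPrincipal) →
        False := by
  intro p hp k K _ _ _ _ O A hk hA hfr hAO hdim hOtop hdvr hres g m _ hcof
  obtain ⟨i, hi, hsing, hrat, S, hTS, hdomS, hSreg, hSeft, hnp⟩ := hcof 0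
  obtain ⟨d, rfl⟩ : ∃ d, i = d + 1 := ⟨i - 1, by omega⟩
  exact hnp (hCAP p hp k K O A hk hA hfr hAO hdim hOtop hdvr hres d hsing hrat S hTS hdomS hSreg hSeft)

/-- **THREE prints + capture at the non-rational stages of PRIME-DIVISOR towers ⇒ `SurfaceTermination` BY NAME** — hand 20's
capture door `surfaceTermination_of_prints_of_nonrationalCapture` with its residue (CAP¬rat) WEAKENED to prime-divisor towers
(three extra binders `O ≠ ⊤`, `IsDiscreteValuationRing O`, `residueTrdeg k O + 1 = trdeg K`), through the meet.
[cite: CossartJannsenSaito2020, Thm. 1.2] [cite: Lipman1969, Theorem (4.1) (p. 204) and Theorem (12.1) (ii) (p. 220)] -/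
theorem surfaceTermination_of_prints3_of_primeDivisorCapture
    (hCJS : CossartJannsenSaito2020General.{0}) (h41 : Lipman1969_4_1.{0}) (h12ii : Lipman1969_12_1_ii.{0})
    (hCAP : ∀ p : ℕ, p.Prime → ∀ (k K : Type) [Field k] [CharP k p] [Field K] [Algebra k K]
      (O : ValuationSubring K) (A : Subalgebra k K) (hk : ∀ c : k, algebraMap k K c ∈ O), A.FG →
      IsFractionRing ↥A K → A.toSubring ≤ O.toSubring → ringKrullDim ↥A = 2 →
      O ≠ ⊤ → IsDiscreteValuationRing ↥O → residueTrdeg k O hk + 1 = Algebra.trdeg k K →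
      ∀ m : ℕ, ¬ IsRegularLocalRing ↥(tower O A (m + 1)) → ¬ HasRationalSingularity ↥(tower O A (m + 1)) →
      ∀ (S : Subalgebra k K) (hTS : tower O A (m + 1) ≤ S),
        (∀ t ∈ tower O A (m + 1), t⁻¹ ∈ S → t⁻¹ ∈ tower O A (m + 1)) →
        IsRegularLocalRing ↥S → Algebra.EssFiniteType k ↥S →
        (Ideal.map (Subalgebra.inclusion hTS).toRingHom
          (cohomologyAnnihilator ↥(tower O A (m + 1)))).IsPrincipal) :
    SurfaceTermination :=
  surfaceTermination_of_prints3_of_meet hCJS h41 h12ii (meet_of_primeDivisorCapture hCAP)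

end Summit.ResolutionOfSingularities.ResolutionOfSingularities.Theorems.SurfaceTermination.PrintDebtDoors

end
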